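import Mathlib
import Summits.NavierStokesRegularity.NavierStokesRegularity.Theorems.SubOnsagerCeilingOrthantTailCeiling.Negative.OrthantTailCeilingFalseOfSideBranchEscape
import Summits.NavierStokesRegularity.NavierStokesRegularity.Theorems.SubOnsagerCeilingForwardTailCeilingTwinReduction
import HarnessLib

/-!
# `SubOnsagerCeiling.ForwardTailCeiling` (stmt-NavierStokesRegularity-26608) — negative lemma modulo
# ANOMALOUS ESCAPE of the side-branch table (`SideBranchEscape`)

Composition of two kernel facts of the tree:

* `forwardTailCeiling_imp_ceilingAt_sideBranchTable` (prover ns-ow-p1 g4,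
  `Theorems/SubOnsagerCeilingForwardTailCeilingTwinReduction.lean`): the rev-2 forward-source ceiling
  `ForwardTailCeiling` implies, at every scale ratio `ε₀ ∈ (0,1]`, the per-table body
  `CeilingAt 10 ε₀ sideBranchTable` of the aside crux `OrthantTailCeiling` on its own witness table
  `α_SB` (twin-table embedding: `twin-α_SB ∈ E₂(17)` is all-source, `S = univ` forced);
* `not_ceilingAt_sideBranch_of_escape` (lead ns-soc-p2 g2,
  `Theorems/SubOnsagerCeilingOrthantTailCeiling/Negative/OrthantTailCeilingFalseOfSideBranchEscape.lean`):
  CEILING ⇒ NO ESCAPE — a dead-end pocket meters the conveyor, so any `ν`-uniform sub-Onsager ceiling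
  on `α_SB` confines its energy to the low shells, contradicting `SideBranchEscapeAt ε₀` (a fixed
  fraction of the energy leaves every block of shells `0..K` within a fixed time at arbitrarily small
  viscosity; a `Prop`, NOTHING asserted, not constructible here).

Hence **`forwardTailCeiling_false_of_sideBranchEscape : SideBranchEscape → ¬ ForwardTailCeiling`**
(the live crux of route SubOnsagerCeiling BY NAME, modulo the same construction hypothesis as the
negative lemma on 25507). The class-restricted restatement the planners prepare (diagonal
inter-shell feeds, Katz–Pavlović networks proper) is NOT touched: `α_SB`'s twin uses a
differential feed.

HONEST FRAMING: MODEL lattice ODEs only (Tao 2016 §4 vocabulary; rung TL-M2Break); a conditional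
refutation; it settles nothing by itself and no summit is proved; nothing here is a statement about
the Navier–Stokes equations. [cite: Tao2016AveragedNS, §4 (4.2)–(4.3), (4.5), (4.8)]
-/

noncomputable section

-- the sub-problem namespace `NavierStokesRegularity.NavierStokesRegularity` is the tree's layout (D-0017)
set_option linter.dupNamespace false

namespace Summit.NavierStokesRegularity.NavierStokesRegularity.Theorems.SubOnsagerCeiling

open Summit.NavierStokesRegularity.NavierStokesRegularity.Theses.SubOnsagerCeiling

/-- **`SideBranchEscapeAt ε₀ → ¬ ForwardTailCeiling`** for any `ε₀ ∈ (0,1]`: the forward-source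
ceiling would give `CeilingAt 10 ε₀ sideBranchTable` (twin reduction), which the escape hypothesis
refutes (`not_ceilingAt_sideBranch_of_escape`). MODEL lattice only; conditional. [this file] -/
theorem forwardTailCeiling_false_of_sideBranchEscapeAt {ε₀ : ℝ} (hε : 0 < ε₀) (hε1 : ε₀ ≤ 1)
    (hH : SideBranchEscapeAt ε₀) : ¬ ForwardTailCeiling := fun h =>
  not_ceilingAt_sideBranch_of_escape hε hH (forwardTailCeiling_imp_ceilingAt_sideBranchTable h hε hε1)

/-- **Negative lemma (conditional refutation of the live crux BY NAME).**
`SideBranchEscape → ¬ ForwardTailCeiling`. MODEL lattice only; conditional; settles nothing by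
itself. [this file] -/
theorem forwardTailCeiling_false_of_sideBranchEscape (hH : SideBranchEscape) : ¬ ForwardTailCeiling := by
  obtain ⟨ε₀, hε, hε1, hHε⟩ := hH
  exact forwardTailCeiling_false_of_sideBranchEscapeAt hε hε1 hHε

end Summit.NavierStokesRegularity.NavierStokesRegularity.Theorems.SubOnsagerCeiling

end
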